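import Literature.NumberTheory.LFunctions.HalaszRestricted
import Literature.NumberTheory.Sieve.PretentiousDistanceProofs
import HarnessLib

/-!
# The halved pretentious distance away from the minimiser of the full distance

Topic `Literature/NumberTheory/LFunctions`.  Everything in this file is PROVED; there are no new
definitions and no named facts.

Halász's theorem for block-restricted sums (`Halasz.Restricted.norm_restr_sum_le`,
`HalaszRestricted.lean`) controls `∑_{n ≤ x, n ∈ 𝒮} g(n)` (`𝒮` = integers with a prime factor in every
block, `E` = the union of the blocks) by the minimum `M_½` of the HALVED distance
`𝔻_½(g, n^{it}; x)² = ∑_{p ≤ x} w_p (1 - Re g(p)p^{-it})/p`, `w_p = ½` on `E` and `1` off `E`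
(`Halasz.Restricted.halfDistSq`).  The only general comparison with the pretentious distance is
`𝔻_½² ≥ 𝔻²/2` (`halfDistSq_ge_half`), which halves every lower bound for `𝔻²` — in the complex
Matomäki–Radziwiłł theorem (Matomäki–Radziwiłł–Tao 2015, Appendix A, Proposition A.3, region `𝒯₂`:
`|t - t₁| ≥ (log X)^{1/16}`, `t₁` the minimiser of `u ↦ 𝔻(f, n^{iu}; X)²`) it would turn the bound
`𝔻(f, p^{it}; X)² ≥ (1/12 - ε) log log X` ("`2𝔻(f, p^{it}) ≥ 𝔻(1, p^{i(t-t₁)})`", loc. cit.) into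
`(1/24 - ε) log log X`, too weak for the exponent `(log X)^{-1/50}` of Proposition A.3 (Matomäki–Radziwiłł
2016, §8.3 needs the cofactor bound `(log X)^{-κ}` with `κ > 3/50`).

This file removes the loss: **away from the minimiser of the FULL distance, the halved distance is at
least a quarter of the twist distance carried by the OFF-block primes** — exactly the constant of the
unrestricted argument.  With `a₀, a_E` the off-block and on-block parts of `𝔻(g, p^{it})²`, `b₀, b_E` those of
`𝔻(g, p^{it₁})²` and `d₀ = ∑_{p ∉ E} (1 - cos((t - t₁) log p))/p`:

  `𝔻_½(g, p^{it})² = a₀ + a_E/2 = a₀/2 + (a₀ + a_E)/2 ≥ a₀/2 + (b₀ + b_E)/2 ≥ (a₀ + b₀)/2 ≥ d₀/4`,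

using minimality `b₀ + b_E ≤ a₀ + a_E` and the triangle inequality `√d₀ ≤ √a₀ + √b₀` on the off-block
primes with `(√a₀ + √b₀)² ≤ 2(a₀ + b₀)`.  In the same way `𝔻_½(g, p^{it})² ≥ 𝔻(p^{it}, p^{it₁})²/8` (all
primes).  Contents:

* `quarter_le_of_min_of_triangle`, `eighth_le_of_min_of_triangle` — the two real inequalities (with a
  slack `δ` in the minimality, so that near-minimisers may be used);
* `halfDistSq_eq_off_add_half_on`, `pretentiousDistSq_twist_eq_off_add_on` — splitting the distances
  into off-block and on-block parts;
* `sqrt_sum_twistDist_le` — the triangle inequality `𝔻_O(p^{it}, p^{it₁}) ≤ 𝔻_O(p^{it}, g) + 𝔻_O(g, p^{it₁})`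
  over an arbitrary finite set `O` of primes (Granville–Soundararajan, via
  `Sieve.sqrt_one_sub_re_mul_conj_le`, `Sieve.sqrt_sum_le_sqrt_sum_add_sqrt_sum`);
* `halfDistSq_ge_quarter_offDist`, `halfDistSq_ge_eighth_twistDist` — the main bounds, and their forms
  `…_of_le_min` with `t₁` a `δ`-near-minimiser of `Sieve.minPretentiousDistSq g x T`, `|t| ≤ T`;
  `offDist_ge_tail`, `halfDistSq_ge_quarter_tail_of_le_min` — the tail form
  `¼ (𝔻(1, n^{i(t-t₁)}; x)² - 𝔻(1, n^{i(t-t₁)}; y)²) - δ/2 ≤ 𝔻_½(g, n^{it}; x)²` when the blocks lie below `y`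
  (the bracket is what the prime number theorem with a Vinogradov–Korobov error term bounds below by
  `(1/3 - ε) log log x - O(1)` for `y = exp((log x)^{2/3+ε})`, `1 ≤ |t - t₁| ≤ x^A`);
* `natCast_cpow_mul_conj_cpow`, `pretentiousDistSq_twist_twist` — `p^{it} · conj(p^{it₁}) = p^{i(t-t₁)}`,
  whence `𝔻(p^{it}, p^{it₁}; x)² = 𝔻(1, p^{i(t-t₁)}; x)²` (the quantity bounded below from `ζ` in
  `PretentiousFord.pretentiousDistSq_one_twist_ge`) and the off-block sum is the corresponding partial sum
  of `∑ (1 - Re p^{i(t-t₁)})/p`;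
* `halfDistSq_mul_twist` — `𝔻_½(g · n^{-is}, n^{iu})² = 𝔻_½(g, n^{i(s+u)})²` (the restricted sum of
  `f(n) n^{-is}` is that of the twisted function), and `minHalfDistSq_twist_ge_of_window` — the window form
  feeding `norm_restr_sum_le`: `M_½(g · n^{-is}; x, T') ≥ c` as soon as `[s - T', s + T'] ⊆ [-T, T]` and the
  off-block twist distance to the minimiser is `≥ 4c` (up to the slack) on that window;
* `exists_isMinOn_pretentiousDistSq_twist` — a minimiser `t₁ ∈ [-T, T]` of `u ↦ 𝔻(g, n^{iu}; x)²` exists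
  and realises `Sieve.minPretentiousDistSq g x T` (continuity on a compact interval).

## References
* K. Matomäki, M. Radziwiłł, T. Tao, *An averaged form of Chowla's conjecture*, Algebra & Number Theory 9
  (2015), Appendix A, proof of Proposition A.3 (the display `2𝔻(f, p^{it}; X) ≥ 𝔻(1, p^{i(t-t₁)})`).
  [cite: MatomakiRadziwillTao2015, Appendix A, Proposition A.3 (proof)]
* K. Matomäki, M. Radziwiłł, *Multiplicative functions in short intervals*, Ann. of Math. 183 (2016),
  Lemma 2 and §8.3. [cite: MatomakiRadziwillAnnals2016, Lemma 2]
* A. Granville, K. Soundararajan, *Pretentious multiplicative functions and an inequality for the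
  zeta-function*, CRM Proc. Lecture Notes 46 (2008), §2 (triangle inequality).
  [cite: GranvilleSoundararajan2008, §2]

## Design choices
* No new definitions: the off-block twist distance is written as the explicit sum
  `∑ p ∈ (Nat.primesLE ⌊x⌋₊).filter (· ∉ E), (1 - Re(p^{it} conj(p^{it₁})))/p`, and twists as
  `fun n : ℕ => (n : ℂ) ^ ((t : ℂ) * I)` (the rendering of `HalaszRestrictedEuler.lean` and
  `Sieve.minPretentiousDistSq`).
* Minimality is asked only relative to the one point `t` and with a slack `δ ≥ 0`
  (`𝔻(g, p^{it₁})² ≤ 𝔻(g, p^{it})² + δ`); the versions over `Sieve.minPretentiousDistSq` are corollaries.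
-/

noncomputable section

open Finset Real Complex
open scoped ComplexConjugate

namespace Literature.NumberTheory.LFunctions

namespace Halasz

namespace Restricted

open Literature.NumberTheory.Sieve (pretentiousDistSq minPretentiousDistSq)

variable {g : ℕ → ℂ}

/-! ### The two real inequalities -/

/-- If `b₀ + b_E ≤ a₀ + a_E + δ` and `√d₀ ≤ √a₀ + √b₀` (all quantities `≥ 0`), then
`d₀/4 - δ/2 ≤ a₀ + a_E/2`: indeed `d₀ ≤ (√a₀ + √b₀)² ≤ 2(a₀ + b₀)` and
`a₀ + a_E/2 = a₀/2 + (a₀ + a_E)/2 ≥ a₀/2 + (b₀ + b_E - δ)/2 ≥ (a₀ + b₀)/2 - δ/2`. [folklore] -/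
theorem quarter_le_of_min_of_triangle {a₀ aE b₀ bE d₀ δ : ℝ} (ha₀ : 0 ≤ a₀) (hb₀ : 0 ≤ b₀)
    (hbE : 0 ≤ bE) (hd₀ : 0 ≤ d₀) (hmin : b₀ + bE ≤ a₀ + aE + δ)
    (htri : Real.sqrt d₀ ≤ Real.sqrt a₀ + Real.sqrt b₀) : d₀ / 4 - δ / 2 ≤ a₀ + aE / 2 := by
  have h1 : d₀ ≤ (Real.sqrt a₀ + Real.sqrt b₀) ^ 2 := by
    calc d₀ = Real.sqrt d₀ ^ 2 := (Real.sq_sqrt hd₀).symm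
      _ ≤ (Real.sqrt a₀ + Real.sqrt b₀) ^ 2 := pow_le_pow_left₀ (Real.sqrt_nonneg _) htri 2
  have h2 : (Real.sqrt a₀ + Real.sqrt b₀) ^ 2 ≤ 2 * (a₀ + b₀) := by
    nlinarith [Real.sq_sqrt ha₀, Real.sq_sqrt hb₀, sq_nonneg (Real.sqrt a₀ - Real.sqrt b₀)]
  linarith

/-- If `b₀ + b_E ≤ a₀ + a_E + δ`, `√d₀ ≤ √a₀ + √b₀` and `√d_E ≤ √a_E + √b_E` (all `≥ 0`), then
`(d₀ + d_E)/8 - δ/4 ≤ a₀ + a_E/2` (`d₀ + d_E ≤ 2(a₀ + b₀) + 2(a_E + b_E) ≤ 4(a₀ + a_E) + 2δ`). [folklore] -/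
theorem eighth_le_of_min_of_triangle {a₀ aE b₀ bE d₀ dE δ : ℝ} (ha₀ : 0 ≤ a₀) (haE : 0 ≤ aE)
    (hb₀ : 0 ≤ b₀) (hbE : 0 ≤ bE) (hd₀ : 0 ≤ d₀) (hdE : 0 ≤ dE) (hmin : b₀ + bE ≤ a₀ + aE + δ)
    (htri₀ : Real.sqrt d₀ ≤ Real.sqrt a₀ + Real.sqrt b₀)
    (htriE : Real.sqrt dE ≤ Real.sqrt aE + Real.sqrt bE) : (d₀ + dE) / 8 - δ / 4 ≤ a₀ + aE / 2 := by
  have h1 : d₀ ≤ (Real.sqrt a₀ + Real.sqrt b₀) ^ 2 := by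
    calc d₀ = Real.sqrt d₀ ^ 2 := (Real.sq_sqrt hd₀).symm
      _ ≤ (Real.sqrt a₀ + Real.sqrt b₀) ^ 2 := pow_le_pow_left₀ (Real.sqrt_nonneg _) htri₀ 2
  have h2 : (Real.sqrt a₀ + Real.sqrt b₀) ^ 2 ≤ 2 * (a₀ + b₀) := by
    nlinarith [Real.sq_sqrt ha₀, Real.sq_sqrt hb₀, sq_nonneg (Real.sqrt a₀ - Real.sqrt b₀)]
  have h3 : dE ≤ (Real.sqrt aE + Real.sqrt bE) ^ 2 := by
    calc dE = Real.sqrt dE ^ 2 := (Real.sq_sqrt hdE).symm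
      _ ≤ (Real.sqrt aE + Real.sqrt bE) ^ 2 := pow_le_pow_left₀ (Real.sqrt_nonneg _) htriE 2
  have h4 : (Real.sqrt aE + Real.sqrt bE) ^ 2 ≤ 2 * (aE + bE) := by
    nlinarith [Real.sq_sqrt haE, Real.sq_sqrt hbE, sq_nonneg (Real.sqrt aE - Real.sqrt bE)]
  linarith

/-! ### Twists `n ↦ n^{it}`: norms, algebra, continuity -/

/-- `‖n^{s}‖ ≤ 1` for every natural `n` and purely imaginary `s` (it is `1` for `n ≥ 1`, and `0` or `1`
at `n = 0`). [folklore] -/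
theorem norm_natCast_cpow_le_one_of_re_eq_zero {s : ℂ} (hs : s.re = 0) (n : ℕ) : ‖(n : ℂ) ^ s‖ ≤ 1 := by
  rcases Nat.eq_zero_or_pos n with rfl | hn
  · rcases eq_or_ne s 0 with h0 | h0
    · simp [h0]
    · simp [Complex.zero_cpow h0]
  · rw [Complex.norm_natCast_cpow_of_pos hn, hs, Real.rpow_zero]

/-- `Re(z conj w) = Re(w conj z)`. [folklore] -/
theorem re_mul_conj_comm (z w : ℂ) : (z * conj w).re = (w * conj z).re := by
  simp only [Complex.mul_re, Complex.conj_re, Complex.conj_im]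
  ring

/-- `p^{it} · conj(p^{it₁}) = p^{i(t - t₁)}` for `p ≥ 1`. [folklore] -/
theorem natCast_cpow_mul_conj_cpow {p : ℕ} (hp : 0 < p) (t t₁ : ℝ) :
    (p : ℂ) ^ ((t : ℂ) * I) * conj ((p : ℂ) ^ ((t₁ : ℂ) * I)) = (p : ℂ) ^ (((t - t₁ : ℝ) : ℂ) * I) := by
  have hpC : (p : ℂ) ≠ 0 := by exact_mod_cast hp.ne'
  have hlog : Complex.log (p : ℂ) = ((Real.log p : ℝ) : ℂ) := by
    rw [← Complex.ofReal_natCast, ← Complex.ofReal_log (Nat.cast_nonneg p)]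
  rw [Complex.cpow_def_of_ne_zero hpC, Complex.cpow_def_of_ne_zero hpC, Complex.cpow_def_of_ne_zero hpC,
    ← Complex.exp_conj, ← Complex.exp_add, hlog]
  congr 1
  simp only [map_mul, Complex.conj_ofReal, Complex.conj_I]
  push_cast
  ring

/-- `conj(p^{is}) · conj(p^{iu}) = conj(p^{i(s+u)})` for `p ≥ 1`, in the form
`(g p · p^{-is}) conj(p^{iu}) = g p · conj(p^{i(s+u)})` used for twisted functions. [folklore] -/
theorem mul_cpow_neg_mul_conj_cpow {p : ℕ} (hp : 0 < p) (c : ℂ) (s u : ℝ) :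
    c * (p : ℂ) ^ (-((s : ℂ) * I)) * conj ((p : ℂ) ^ ((u : ℂ) * I)) =
      c * conj ((p : ℂ) ^ (((s + u : ℝ) : ℂ) * I)) := by
  have hpC : (p : ℂ) ≠ 0 := by exact_mod_cast hp.ne'
  have hlog : Complex.log (p : ℂ) = ((Real.log p : ℝ) : ℂ) := by
    rw [← Complex.ofReal_natCast, ← Complex.ofReal_log (Nat.cast_nonneg p)]
  rw [mul_assoc]
  congr 1
  rw [Complex.cpow_def_of_ne_zero hpC, Complex.cpow_def_of_ne_zero hpC, Complex.cpow_def_of_ne_zero hpC,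
    ← Complex.exp_conj, ← Complex.exp_conj, ← Complex.exp_add, hlog]
  congr 1
  simp only [map_mul, Complex.conj_ofReal, Complex.conj_I]
  push_cast
  ring

/-- Continuity of `u ↦ 𝔻(g, n^{iu}; x)²` (a finite sum of continuous functions of `u`). [folklore] -/
theorem continuous_pretentiousDistSq_twist (g : ℕ → ℂ) (x : ℝ) :
    Continuous fun u : ℝ => pretentiousDistSq g (fun n : ℕ => (n : ℂ) ^ ((u : ℂ) * I)) x := by
  unfold pretentiousDistSq
  refine continuous_finsetSum _ fun p hp => ?_
  rw [Nat.mem_primesLE] at hp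
  have hpC : (p : ℂ) ≠ 0 := by exact_mod_cast hp.2.pos.ne'
  have : (fun u : ℝ => (p : ℂ) ^ ((u : ℂ) * I)) = fun u : ℝ => Complex.exp (Complex.log p * ((u : ℂ) * I)) := by
    funext u; exact Complex.cpow_def_of_ne_zero hpC _
  refine Continuous.div_const (continuous_const.sub (Complex.continuous_re.comp
    (continuous_const.mul (Complex.continuous_conj.comp ?_)))) _
  rw [this]; fun_prop

/-- **A minimiser exists**: for `T ≥ 0` there is `t₁ ∈ [-T, T]` minimising `u ↦ 𝔻(g, n^{iu}; x)²` on
`[-T, T]`, and `𝔻(g, n^{it₁}; x)² = M(x, T)` (`Sieve.minPretentiousDistSq`). [folklore] -/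
theorem exists_isMinOn_pretentiousDistSq_twist (hgb : ∀ n, ‖g n‖ ≤ 1) (x : ℝ) {T : ℝ} (hT : 0 ≤ T) :
    ∃ t₁ : ℝ, |t₁| ≤ T ∧
      (∀ u : ℝ, |u| ≤ T → pretentiousDistSq g (fun n : ℕ => (n : ℂ) ^ ((t₁ : ℂ) * I)) x ≤
        pretentiousDistSq g (fun n : ℕ => (n : ℂ) ^ ((u : ℂ) * I)) x) ∧
      pretentiousDistSq g (fun n : ℕ => (n : ℂ) ^ ((t₁ : ℂ) * I)) x = minPretentiousDistSq g x T := by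
  set F : ℝ → ℝ := fun u => pretentiousDistSq g (fun n : ℕ => (n : ℂ) ^ ((u : ℂ) * I)) x with hF
  have hcont : Continuous F := continuous_pretentiousDistSq_twist g x
  have hne : (Set.Icc (-T) T).Nonempty := ⟨0, by simp [hT]⟩
  obtain ⟨t₁, ht₁, hmin⟩ := isCompact_Icc.exists_isMinOn hne hcont.continuousOn
  have habs : ∀ u : ℝ, |u| ≤ T ↔ u ∈ Set.Icc (-T) T := fun u => by
    rw [Set.mem_Icc, abs_le]
  have hmin' : ∀ u : ℝ, |u| ≤ T → F t₁ ≤ F u := fun u hu => hmin ((habs u).1 hu)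
  refine ⟨t₁, (habs t₁).2 ht₁, hmin', ?_⟩
  have hne' : Nonempty (Set.Icc (-T) T) := ⟨⟨0, by simp [hT]⟩⟩
  refine le_antisymm (le_ciInf fun u => hmin u.2) ?_
  exact minPretentiousDistSq_le_of_abs_le hgb x ((habs t₁).2 ht₁)

/-! ### Splitting the distances into off-block and on-block parts -/

/-- `𝔻_½(g, n^{it}; x)² = ∑_{p ∉ E} (1 - Re g(p)p^{-it})/p + ½ ∑_{p ∈ E} (1 - Re g(p)p^{-it})/p`
(primes `p ≤ x`). [folklore] -/
theorem halfDistSq_eq_off_add_half_on (E : Finset ℕ) (g : ℕ → ℂ) (t x : ℝ) :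
    halfDistSq E g t x =
      (∑ p ∈ (Nat.primesLE ⌊x⌋₊).filter (· ∉ E), (1 - (g p * conj ((p : ℂ) ^ ((t : ℂ) * I))).re) / p) +
        (1 / 2) * ∑ p ∈ (Nat.primesLE ⌊x⌋₊).filter (· ∈ E),
          (1 - (g p * conj ((p : ℂ) ^ ((t : ℂ) * I))).re) / p := by
  unfold halfDistSq
  rw [← Finset.sum_filter_add_sum_filter_not (Nat.primesLE ⌊x⌋₊) (· ∈ E), add_comm, Finset.mul_sum]
  congr 1
  · refine Finset.sum_congr rfl fun p hp => ?_
    rw [Finset.mem_filter] at hp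
    simp [halfWeight, hp.2]
  · refine Finset.sum_congr rfl fun p hp => ?_
    rw [Finset.mem_filter] at hp
    simp [halfWeight, hp.2]

/-- `𝔻(g, n^{it}; x)² = ∑_{p ∉ E} (1 - Re g(p)p^{-it})/p + ∑_{p ∈ E} (1 - Re g(p)p^{-it})/p`. [folklore] -/
theorem pretentiousDistSq_twist_eq_off_add_on (E : Finset ℕ) (g : ℕ → ℂ) (t x : ℝ) :
    pretentiousDistSq g (fun n : ℕ => (n : ℂ) ^ ((t : ℂ) * I)) x =
      (∑ p ∈ (Nat.primesLE ⌊x⌋₊).filter (· ∉ E), (1 - (g p * conj ((p : ℂ) ^ ((t : ℂ) * I))).re) / p) +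
        ∑ p ∈ (Nat.primesLE ⌊x⌋₊).filter (· ∈ E), (1 - (g p * conj ((p : ℂ) ^ ((t : ℂ) * I))).re) / p := by
  unfold pretentiousDistSq
  rw [← Finset.sum_filter_add_sum_filter_not (Nat.primesLE ⌊x⌋₊) (· ∈ E), add_comm]

/-- The twist distance over all primes splits likewise:
`𝔻(n^{it}, n^{it₁}; x)² = ∑_{p ∉ E} (1 - Re(p^{it} conj p^{it₁}))/p + ∑_{p ∈ E} (…)/p`. [folklore] -/
theorem pretentiousDistSq_twist_twist_eq_off_add_on (E : Finset ℕ) (t t₁ x : ℝ) :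
    pretentiousDistSq (fun n : ℕ => (n : ℂ) ^ ((t : ℂ) * I)) (fun n : ℕ => (n : ℂ) ^ ((t₁ : ℂ) * I)) x =
      (∑ p ∈ (Nat.primesLE ⌊x⌋₊).filter (· ∉ E),
          (1 - ((p : ℂ) ^ ((t : ℂ) * I) * conj ((p : ℂ) ^ ((t₁ : ℂ) * I))).re) / p) +
        ∑ p ∈ (Nat.primesLE ⌊x⌋₊).filter (· ∈ E),
          (1 - ((p : ℂ) ^ ((t : ℂ) * I) * conj ((p : ℂ) ^ ((t₁ : ℂ) * I))).re) / p := by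
  unfold pretentiousDistSq
  rw [← Finset.sum_filter_add_sum_filter_not (Nat.primesLE ⌊x⌋₊) (· ∈ E), add_comm]

/-- `𝔻(n^{it}, n^{it₁}; x)² = 𝔻(1, n^{i(t - t₁)}; x)²` — the quantity bounded below via `ζ(1 + i(t-t₁))`
in `PretentiousFord.pretentiousDistSq_one_twist_ge`. [folklore] -/
theorem pretentiousDistSq_twist_twist (t t₁ x : ℝ) :
    pretentiousDistSq (fun n : ℕ => (n : ℂ) ^ ((t : ℂ) * I)) (fun n : ℕ => (n : ℂ) ^ ((t₁ : ℂ) * I)) x =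
      pretentiousDistSq 1 (fun n : ℕ => (n : ℂ) ^ (((t - t₁ : ℝ) : ℂ) * I)) x := by
  unfold pretentiousDistSq
  refine Finset.sum_congr rfl fun p hp => ?_
  rw [Nat.mem_primesLE] at hp
  rw [natCast_cpow_mul_conj_cpow hp.2.pos, Pi.one_apply, one_mul, Complex.conj_re]

/-- The off-block part of `𝔻(n^{it}, n^{it₁}; x)²` is the corresponding partial sum of
`∑ (1 - Re p^{i(t-t₁)})/p = ∑ (1 - cos((t - t₁) log p))/p`. [folklore] -/
theorem sum_filter_twistDist_eq (E : Finset ℕ) (t t₁ x : ℝ) :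
    ∑ p ∈ (Nat.primesLE ⌊x⌋₊).filter (· ∉ E),
        (1 - ((p : ℂ) ^ ((t : ℂ) * I) * conj ((p : ℂ) ^ ((t₁ : ℂ) * I))).re) / p =
      ∑ p ∈ (Nat.primesLE ⌊x⌋₊).filter (· ∉ E), (1 - ((p : ℂ) ^ (((t - t₁ : ℝ) : ℂ) * I)).re) / p := by
  refine Finset.sum_congr rfl fun p hp => ?_
  rw [Finset.mem_filter, Nat.mem_primesLE] at hp
  rw [natCast_cpow_mul_conj_cpow hp.1.2.pos]

/-- **Tail form of the off-block distance**: if all primes of `E` are `≤ y`, then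
`𝔻(1, n^{i(t-t₁)}; x)² - 𝔻(1, n^{i(t-t₁)}; y)² ≤ ∑_{p ≤ x, p ∉ E} (1 - Re(p^{it} conj p^{it₁}))/p`
(the primes of `(y, x]` are off-block and all summands are nonnegative).  In Matomäki–Radziwiłł's setting
the blocks lie below `exp(√log X)` and the left side, with `y = exp((log X)^{2/3+ε})`, is
`≥ (1/3 - ε) log log X - O(1)` by the prime number theorem with the Vinogradov–Korobov error term
(Matomäki–Radziwiłł 2016, proof of Lemma 2). [cite: MatomakiRadziwillAnnals2016, Lemma 2 (proof)] -/
theorem offDist_ge_tail (E : Finset ℕ) {y : ℝ} (hE : ∀ p ∈ E, (p : ℝ) ≤ y) (t t₁ x : ℝ) :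
    pretentiousDistSq 1 (fun n : ℕ => (n : ℂ) ^ (((t - t₁ : ℝ) : ℂ) * I)) x -
        pretentiousDistSq 1 (fun n : ℕ => (n : ℂ) ^ (((t - t₁ : ℝ) : ℂ) * I)) y ≤
      ∑ p ∈ (Nat.primesLE ⌊x⌋₊).filter (· ∉ E),
        (1 - ((p : ℂ) ^ ((t : ℂ) * I) * conj ((p : ℂ) ^ ((t₁ : ℂ) * I))).re) / p := by
  rw [sum_filter_twistDist_eq]
  set f : ℕ → ℝ := fun p => (1 - ((p : ℂ) ^ (((t - t₁ : ℝ) : ℂ) * I)).re) / p with hf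
  have hτ : ∀ n : ℕ, ‖(n : ℂ) ^ (((t - t₁ : ℝ) : ℂ) * I)‖ ≤ 1 :=
    norm_natCast_cpow_le_one_of_re_eq_zero (by simp)
  have h1b : ∀ n : ℕ, ‖(1 : ℕ → ℂ) n‖ ≤ 1 := fun n => by simp
  have hf0 : ∀ p : ℕ, 0 ≤ f p := fun p => by
    have h := Sieve.pretentiousDistSq_summand_nonneg h1b hτ p
    simpa only [Pi.one_apply, one_mul, Complex.conj_re] using h
  have hsum : ∀ z : ℝ, pretentiousDistSq 1 (fun n : ℕ => (n : ℂ) ^ (((t - t₁ : ℝ) : ℂ) * I)) z =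
      ∑ p ∈ Nat.primesLE ⌊z⌋₊, f p := fun z => by
    unfold pretentiousDistSq
    refine Finset.sum_congr rfl fun p _ => ?_
    simp only [Pi.one_apply, one_mul, Complex.conj_re, hf]
  rw [hsum, hsum]
  have h1 : ∑ p ∈ (Nat.primesLE ⌊x⌋₊).filter (fun p => ¬ p ≤ ⌊y⌋₊), f p ≤
      ∑ p ∈ (Nat.primesLE ⌊x⌋₊).filter (· ∉ E), f p := by
    refine Finset.sum_le_sum_of_subset_of_nonneg (fun p hp => ?_) (fun p _ _ => hf0 p)
    rw [Finset.mem_filter] at hp ⊢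
    exact ⟨hp.1, fun hpE => hp.2 (Nat.le_floor (hE p hpE))⟩
  have h2 : ∑ p ∈ (Nat.primesLE ⌊x⌋₊).filter (fun p => ¬ p ≤ ⌊y⌋₊), f p =
      ∑ p ∈ Nat.primesLE ⌊x⌋₊, f p - ∑ p ∈ (Nat.primesLE ⌊x⌋₊).filter (fun p => p ≤ ⌊y⌋₊), f p := by
    rw [← Finset.sum_filter_add_sum_filter_not (Nat.primesLE ⌊x⌋₊) (fun p => p ≤ ⌊y⌋₊)]
    ring
  have h3 : ∑ p ∈ (Nat.primesLE ⌊x⌋₊).filter (fun p => p ≤ ⌊y⌋₊), f p ≤ ∑ p ∈ Nat.primesLE ⌊y⌋₊, f p := by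
    refine Finset.sum_le_sum_of_subset_of_nonneg (fun p hp => ?_) (fun p _ _ => hf0 p)
    rw [Finset.mem_filter, Nat.mem_primesLE] at hp
    rw [Nat.mem_primesLE]
    exact ⟨hp.2, hp.1.2⟩
  linarith

/-! ### The triangle inequality over a set of primes -/

/-- **Granville–Soundararajan's triangle inequality over a finite set `O`**:
`√(∑_{p ∈ O} (1 - Re(p^{it} conj p^{it₁}))/p) ≤ √(∑_{p ∈ O} (1 - Re g(p)p^{-it})/p) + √(∑_{p ∈ O} (1 - Re g(p)p^{-it₁})/p)`
for `|g| ≤ 1`, i.e. `𝔻_O(n^{it}, n^{it₁}) ≤ 𝔻_O(n^{it}, g) + 𝔻_O(g, n^{it₁})`.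
[cite: GranvilleSoundararajan2008, §2, eq. (5)] -/
theorem sqrt_sum_twistDist_le (hgb : ∀ n, ‖g n‖ ≤ 1) (O : Finset ℕ) (t t₁ : ℝ) :
    Real.sqrt (∑ p ∈ O, (1 - ((p : ℂ) ^ ((t : ℂ) * I) * conj ((p : ℂ) ^ ((t₁ : ℂ) * I))).re) / p) ≤
      Real.sqrt (∑ p ∈ O, (1 - (g p * conj ((p : ℂ) ^ ((t : ℂ) * I))).re) / p) +
        Real.sqrt (∑ p ∈ O, (1 - (g p * conj ((p : ℂ) ^ ((t₁ : ℂ) * I))).re) / p) := by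
  have hτt : ∀ n : ℕ, ‖(n : ℂ) ^ (((t : ℝ) : ℂ) * I)‖ ≤ 1 :=
    norm_natCast_cpow_le_one_of_re_eq_zero (by simp)
  have hτt₁ : ∀ n : ℕ, ‖(n : ℂ) ^ (((t₁ : ℝ) : ℂ) * I)‖ ≤ 1 :=
    norm_natCast_cpow_le_one_of_re_eq_zero (by simp)
  have key := Sieve.sqrt_sum_le_sqrt_sum_add_sqrt_sum O
    (u := fun p : ℕ => (1 - ((p : ℂ) ^ ((t : ℂ) * I) * conj ((p : ℂ) ^ ((t₁ : ℂ) * I))).re) / p)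
    (s := fun p : ℕ => (1 - ((p : ℂ) ^ ((t : ℂ) * I) * conj (g p)).re) / p)
    (t := fun p : ℕ => (1 - (g p * conj ((p : ℂ) ^ ((t₁ : ℂ) * I))).re) / p)
    (Sieve.pretentiousDistSq_summand_nonneg hτt hτt₁)
    (Sieve.pretentiousDistSq_summand_nonneg hτt hgb)
    (Sieve.pretentiousDistSq_summand_nonneg hgb hτt₁) ?_
  · have hmid : ∑ p ∈ O, (1 - ((p : ℂ) ^ ((t : ℂ) * I) * conj (g p)).re) / p =
        ∑ p ∈ O, (1 - (g p * conj ((p : ℂ) ^ ((t : ℂ) * I))).re) / p :=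
      Finset.sum_congr rfl fun p _ => by rw [re_mul_conj_comm]
    simpa only [hmid] using key
  · intro p _
    have hp0 : (0 : ℝ) ≤ p := Nat.cast_nonneg p
    rw [Real.sqrt_div' _ hp0, Real.sqrt_div' _ hp0, Real.sqrt_div' _ hp0, ← add_div]
    exact div_le_div_of_nonneg_right
      (Sieve.sqrt_one_sub_re_mul_conj_le (hτt p) (hgb p) (hτt₁ p)) (Real.sqrt_nonneg _)

/-! ### The main bounds -/

/-- **The halved distance off the minimiser, off-block form.**  Let `|g| ≤ 1`, `E` a finite set (the
block primes), `t, t₁, δ` real with `𝔻(g, n^{it₁}; x)² ≤ 𝔻(g, n^{it}; x)² + δ` (`t₁` a `δ`-near-minimiser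
relative to `t`).  Then
`¼ ∑_{p ≤ x, p ∉ E} (1 - Re(p^{it} conj p^{it₁}))/p - δ/2 ≤ 𝔻_½(g, n^{it}; x)²`.
With `a₀, a_E` (`b₀, b_E`) the off-block and on-block parts of `𝔻(g, n^{it})²` (`𝔻(g, n^{it₁})²`) and `d₀` the
left sum: `𝔻_½² = a₀ + a_E/2 ≥ a₀/2 + (b₀ + b_E - δ)/2 ≥ (a₀ + b₀)/2 - δ/2 ≥ d₀/4 - δ/2` by
`√d₀ ≤ √a₀ + √b₀` (`sqrt_sum_twistDist_le`). [folklore] -/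
theorem halfDistSq_ge_quarter_offDist (hgb : ∀ n, ‖g n‖ ≤ 1) (E : Finset ℕ) {x t t₁ δ : ℝ}
    (hmin : pretentiousDistSq g (fun n : ℕ => (n : ℂ) ^ ((t₁ : ℂ) * I)) x ≤
      pretentiousDistSq g (fun n : ℕ => (n : ℂ) ^ ((t : ℂ) * I)) x + δ) :
    (∑ p ∈ (Nat.primesLE ⌊x⌋₊).filter (· ∉ E),
        (1 - ((p : ℂ) ^ ((t : ℂ) * I) * conj ((p : ℂ) ^ ((t₁ : ℂ) * I))).re) / p) / 4 - δ / 2 ≤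
      halfDistSq E g t x := by
  have hτt : ∀ n : ℕ, ‖(n : ℂ) ^ (((t : ℝ) : ℂ) * I)‖ ≤ 1 :=
    norm_natCast_cpow_le_one_of_re_eq_zero (by simp)
  have hτt₁ : ∀ n : ℕ, ‖(n : ℂ) ^ (((t₁ : ℝ) : ℂ) * I)‖ ≤ 1 :=
    norm_natCast_cpow_le_one_of_re_eq_zero (by simp)
  set O := (Nat.primesLE ⌊x⌋₊).filter (· ∉ E) with hO
  set B := (Nat.primesLE ⌊x⌋₊).filter (· ∈ E) with hB
  set a₀ := ∑ p ∈ O, (1 - (g p * conj ((p : ℂ) ^ ((t : ℂ) * I))).re) / p with ha₀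
  set aE := ∑ p ∈ B, (1 - (g p * conj ((p : ℂ) ^ ((t : ℂ) * I))).re) / p with haE
  set b₀ := ∑ p ∈ O, (1 - (g p * conj ((p : ℂ) ^ ((t₁ : ℂ) * I))).re) / p with hb₀
  set bE := ∑ p ∈ B, (1 - (g p * conj ((p : ℂ) ^ ((t₁ : ℂ) * I))).re) / p with hbE
  set d₀ := ∑ p ∈ O, (1 - ((p : ℂ) ^ ((t : ℂ) * I) * conj ((p : ℂ) ^ ((t₁ : ℂ) * I))).re) / p with hd₀
  have hhalf : halfDistSq E g t x = a₀ + aE / 2 := by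
    rw [halfDistSq_eq_off_add_half_on]; ring
  have hDt : pretentiousDistSq g (fun n : ℕ => (n : ℂ) ^ ((t : ℂ) * I)) x = a₀ + aE :=
    pretentiousDistSq_twist_eq_off_add_on E g t x
  have hDt₁ : pretentiousDistSq g (fun n : ℕ => (n : ℂ) ^ ((t₁ : ℂ) * I)) x = b₀ + bE :=
    pretentiousDistSq_twist_eq_off_add_on E g t₁ x
  rw [hDt, hDt₁] at hmin
  have ha₀0 : 0 ≤ a₀ := Finset.sum_nonneg fun p _ => Sieve.pretentiousDistSq_summand_nonneg hgb hτt p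
  have hb₀0 : 0 ≤ b₀ := Finset.sum_nonneg fun p _ => Sieve.pretentiousDistSq_summand_nonneg hgb hτt₁ p
  have hbE0 : 0 ≤ bE := Finset.sum_nonneg fun p _ => Sieve.pretentiousDistSq_summand_nonneg hgb hτt₁ p
  have hd₀0 : 0 ≤ d₀ := Finset.sum_nonneg fun p _ => Sieve.pretentiousDistSq_summand_nonneg hτt hτt₁ p
  have htri : Real.sqrt d₀ ≤ Real.sqrt a₀ + Real.sqrt b₀ := sqrt_sum_twistDist_le hgb O t t₁
  rw [hhalf]
  exact quarter_le_of_min_of_triangle ha₀0 hb₀0 hbE0 hd₀0 hmin htri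

/-- **The halved distance off the minimiser, all-primes form**: under the same near-minimality,
`⅛ 𝔻(n^{it}, n^{it₁}; x)² - δ/4 ≤ 𝔻_½(g, n^{it}; x)²` (no restriction on where the blocks lie).
[folklore] -/
theorem halfDistSq_ge_eighth_twistDist (hgb : ∀ n, ‖g n‖ ≤ 1) (E : Finset ℕ) {x t t₁ δ : ℝ}
    (hmin : pretentiousDistSq g (fun n : ℕ => (n : ℂ) ^ ((t₁ : ℂ) * I)) x ≤
      pretentiousDistSq g (fun n : ℕ => (n : ℂ) ^ ((t : ℂ) * I)) x + δ) :
    pretentiousDistSq (fun n : ℕ => (n : ℂ) ^ ((t : ℂ) * I)) (fun n : ℕ => (n : ℂ) ^ ((t₁ : ℂ) * I)) x / 8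
        - δ / 4 ≤ halfDistSq E g t x := by
  have hτt : ∀ n : ℕ, ‖(n : ℂ) ^ (((t : ℝ) : ℂ) * I)‖ ≤ 1 :=
    norm_natCast_cpow_le_one_of_re_eq_zero (by simp)
  have hτt₁ : ∀ n : ℕ, ‖(n : ℂ) ^ (((t₁ : ℝ) : ℂ) * I)‖ ≤ 1 :=
    norm_natCast_cpow_le_one_of_re_eq_zero (by simp)
  set O := (Nat.primesLE ⌊x⌋₊).filter (· ∉ E) with hO
  set B := (Nat.primesLE ⌊x⌋₊).filter (· ∈ E) with hB
  set a₀ := ∑ p ∈ O, (1 - (g p * conj ((p : ℂ) ^ ((t : ℂ) * I))).re) / p with ha₀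
  set aE := ∑ p ∈ B, (1 - (g p * conj ((p : ℂ) ^ ((t : ℂ) * I))).re) / p with haE
  set b₀ := ∑ p ∈ O, (1 - (g p * conj ((p : ℂ) ^ ((t₁ : ℂ) * I))).re) / p with hb₀
  set bE := ∑ p ∈ B, (1 - (g p * conj ((p : ℂ) ^ ((t₁ : ℂ) * I))).re) / p with hbE
  set d₀ := ∑ p ∈ O, (1 - ((p : ℂ) ^ ((t : ℂ) * I) * conj ((p : ℂ) ^ ((t₁ : ℂ) * I))).re) / p with hd₀
  set dE := ∑ p ∈ B, (1 - ((p : ℂ) ^ ((t : ℂ) * I) * conj ((p : ℂ) ^ ((t₁ : ℂ) * I))).re) / p with hdE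
  have hhalf : halfDistSq E g t x = a₀ + aE / 2 := by
    rw [halfDistSq_eq_off_add_half_on]; ring
  have hDt : pretentiousDistSq g (fun n : ℕ => (n : ℂ) ^ ((t : ℂ) * I)) x = a₀ + aE :=
    pretentiousDistSq_twist_eq_off_add_on E g t x
  have hDt₁ : pretentiousDistSq g (fun n : ℕ => (n : ℂ) ^ ((t₁ : ℂ) * I)) x = b₀ + bE :=
    pretentiousDistSq_twist_eq_off_add_on E g t₁ x
  have hd : pretentiousDistSq (fun n : ℕ => (n : ℂ) ^ ((t : ℂ) * I)) (fun n : ℕ => (n : ℂ) ^ ((t₁ : ℂ) * I)) x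
      = d₀ + dE := pretentiousDistSq_twist_twist_eq_off_add_on E t t₁ x
  rw [hDt, hDt₁] at hmin
  have ha₀0 : 0 ≤ a₀ := Finset.sum_nonneg fun p _ => Sieve.pretentiousDistSq_summand_nonneg hgb hτt p
  have haE0 : 0 ≤ aE := Finset.sum_nonneg fun p _ => Sieve.pretentiousDistSq_summand_nonneg hgb hτt p
  have hb₀0 : 0 ≤ b₀ := Finset.sum_nonneg fun p _ => Sieve.pretentiousDistSq_summand_nonneg hgb hτt₁ p
  have hbE0 : 0 ≤ bE := Finset.sum_nonneg fun p _ => Sieve.pretentiousDistSq_summand_nonneg hgb hτt₁ p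
  have hd₀0 : 0 ≤ d₀ := Finset.sum_nonneg fun p _ => Sieve.pretentiousDistSq_summand_nonneg hτt hτt₁ p
  have hdE0 : 0 ≤ dE := Finset.sum_nonneg fun p _ => Sieve.pretentiousDistSq_summand_nonneg hτt hτt₁ p
  have htri₀ : Real.sqrt d₀ ≤ Real.sqrt a₀ + Real.sqrt b₀ := sqrt_sum_twistDist_le hgb O t t₁
  have htriE : Real.sqrt dE ≤ Real.sqrt aE + Real.sqrt bE := sqrt_sum_twistDist_le hgb B t t₁
  rw [hhalf, hd]
  exact eighth_le_of_min_of_triangle ha₀0 haE0 hb₀0 hbE0 hd₀0 hdE0 hmin htri₀ htriE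

/-- Off-block form with `t₁` a `δ`-near-minimiser of `M(x, T) = min_{|u| ≤ T} 𝔻(g, n^{iu}; x)²`
(`Sieve.minPretentiousDistSq`) and `|t| ≤ T`:
`¼ ∑_{p ≤ x, p ∉ E} (1 - Re(p^{it} conj p^{it₁}))/p - δ/2 ≤ 𝔻_½(g, n^{it}; x)²`. [folklore] -/
theorem halfDistSq_ge_quarter_offDist_of_le_min (hgb : ∀ n, ‖g n‖ ≤ 1) (E : Finset ℕ)
    {x T t t₁ δ : ℝ} (ht : |t| ≤ T)
    (hmin : pretentiousDistSq g (fun n : ℕ => (n : ℂ) ^ ((t₁ : ℂ) * I)) x ≤ minPretentiousDistSq g x T + δ) :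
    (∑ p ∈ (Nat.primesLE ⌊x⌋₊).filter (· ∉ E),
        (1 - ((p : ℂ) ^ ((t : ℂ) * I) * conj ((p : ℂ) ^ ((t₁ : ℂ) * I))).re) / p) / 4 - δ / 2 ≤
      halfDistSq E g t x := by
  refine halfDistSq_ge_quarter_offDist hgb E (hmin.trans ?_)
  have := minPretentiousDistSq_le_of_abs_le hgb x ht
  linarith

/-- All-primes form with `t₁` a `δ`-near-minimiser of `M(x, T)` and `|t| ≤ T`:
`⅛ 𝔻(1, n^{i(t-t₁)}; x)² - δ/4 ≤ 𝔻_½(g, n^{it}; x)²`. [folklore] -/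
theorem halfDistSq_ge_eighth_twistDist_of_le_min (hgb : ∀ n, ‖g n‖ ≤ 1) (E : Finset ℕ)
    {x T t t₁ δ : ℝ} (ht : |t| ≤ T)
    (hmin : pretentiousDistSq g (fun n : ℕ => (n : ℂ) ^ ((t₁ : ℂ) * I)) x ≤ minPretentiousDistSq g x T + δ) :
    pretentiousDistSq 1 (fun n : ℕ => (n : ℂ) ^ (((t - t₁ : ℝ) : ℂ) * I)) x / 8 - δ / 4 ≤
      halfDistSq E g t x := by
  rw [← pretentiousDistSq_twist_twist]
  refine halfDistSq_ge_eighth_twistDist hgb E (hmin.trans ?_)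
  have := minPretentiousDistSq_le_of_abs_le hgb x ht
  linarith

/-- **Tail form of the main bound**: if the primes of `E` are `≤ y`, `|t| ≤ T` and `t₁` is a
`δ`-near-minimiser of `M(x, T)`, then
`¼ (𝔻(1, n^{i(t-t₁)}; x)² - 𝔻(1, n^{i(t-t₁)}; y)²) - δ/2 ≤ 𝔻_½(g, n^{it}; x)²`.
This is the input of the region `𝒯₂` of Matomäki–Radziwiłł–Tao 2015, Prop. A.3, for RESTRICTED sums:
with the blocks below `exp(√log X) ≤ y = exp((log X)^{2/3+ε})` and `|t - t₁| ≥ 1` the bracket is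
`≥ (1/3 - ε) log log X - O(1)`, so `𝔻_½ ≥ (1/12 - ε) log log X - O(1)`, the same constant as for the
unrestricted sum. [cite: MatomakiRadziwillTao2015, Appendix A, Proposition A.3 (proof)] -/
theorem halfDistSq_ge_quarter_tail_of_le_min (hgb : ∀ n, ‖g n‖ ≤ 1) {E : Finset ℕ} {y : ℝ}
    (hE : ∀ p ∈ E, (p : ℝ) ≤ y) {x T t t₁ δ : ℝ} (ht : |t| ≤ T)
    (hmin : pretentiousDistSq g (fun n : ℕ => (n : ℂ) ^ ((t₁ : ℂ) * I)) x ≤ minPretentiousDistSq g x T + δ) :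
    (pretentiousDistSq 1 (fun n : ℕ => (n : ℂ) ^ (((t - t₁ : ℝ) : ℂ) * I)) x -
        pretentiousDistSq 1 (fun n : ℕ => (n : ℂ) ^ (((t - t₁ : ℝ) : ℂ) * I)) y) / 4 - δ / 2 ≤
      halfDistSq E g t x := by
  have h1 := offDist_ge_tail E hE t t₁ x
  have h2 := halfDistSq_ge_quarter_offDist_of_le_min hgb E ht hmin
  linarith

/-! ### Twisted functions and the window form for `norm_restr_sum_le` -/

/-- **Twist shift**: `𝔻_½(g · n^{-is}, n^{iu}; x)² = 𝔻_½(g, n^{i(s+u)}; x)²` — the block-restricted sum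
of `f(n) n^{-is}` is the restricted sum of the twisted function `n ↦ f(n) n^{-is}`, whose halved distance
from `n^{iu}` is that of `f` from `n^{i(s+u)}`. [folklore] -/
theorem halfDistSq_mul_twist (E : Finset ℕ) (g : ℕ → ℂ) (s u x : ℝ) :
    halfDistSq E (fun n : ℕ => g n * (n : ℂ) ^ (-((s : ℂ) * I))) u x = halfDistSq E g (s + u) x := by
  unfold halfDistSq
  refine Finset.sum_congr rfl fun p hp => ?_
  rw [Nat.mem_primesLE] at hp
  rw [mul_cpow_neg_mul_conj_cpow hp.2.pos]

/-- The twisted function is again bounded by `1`. [folklore] -/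
theorem norm_mul_twist_le (hgb : ∀ n, ‖g n‖ ≤ 1) (s : ℝ) (n : ℕ) :
    ‖g n * (n : ℂ) ^ (-((s : ℂ) * I))‖ ≤ 1 := by
  rw [norm_mul]
  have h2 : ‖(n : ℂ) ^ (-((s : ℂ) * I))‖ ≤ 1 := norm_natCast_cpow_le_one_of_re_eq_zero (by simp) n
  exact mul_le_one₀ (hgb n) (norm_nonneg _) h2

/-- **The window form.**  Let `|g| ≤ 1`, `T' ≥ 0`, `t₁` a `δ`-near-minimiser of `M(x, T)`, and suppose
that for every `u` with `|u - s| ≤ T'` one has `|u| ≤ T` and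
`4c + 2δ ≤ ∑_{p ≤ x, p ∉ E} (1 - Re(p^{iu} conj p^{it₁}))/p`.  Then the minimum over `|u| ≤ T'` of the
halved distance of the twisted function `n ↦ g(n) n^{-is}` is at least `c`:
`c ≤ M_½(g · n^{-is}; x, T')` (`minHalfDistSq`, the quantity in `norm_restr_sum_le`).  In the complex
Matomäki–Radziwiłł theorem this is used with `[s - T', s + T'] ∩ [t₁ - 1, t₁ + 1] = ∅` and the lower
bound for the off-block twist distance supplied by the prime number theorem. [folklore] -/
theorem minHalfDistSq_twist_ge_of_window (hgb : ∀ n, ‖g n‖ ≤ 1) (E : Finset ℕ)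
    {x T T' s t₁ δ c : ℝ} (hT' : 0 ≤ T')
    (hmin : pretentiousDistSq g (fun n : ℕ => (n : ℂ) ^ ((t₁ : ℂ) * I)) x ≤ minPretentiousDistSq g x T + δ)
    (hwin : ∀ u : ℝ, |u - s| ≤ T' → |u| ≤ T ∧
      4 * c + 2 * δ ≤ ∑ p ∈ (Nat.primesLE ⌊x⌋₊).filter (· ∉ E),
        (1 - ((p : ℂ) ^ ((u : ℂ) * I) * conj ((p : ℂ) ^ ((t₁ : ℂ) * I))).re) / p) :
    c ≤ minHalfDistSq E (fun n : ℕ => g n * (n : ℂ) ^ (-((s : ℂ) * I))) x T' := by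
  have hne : Nonempty (Set.Icc (-T') T') := ⟨⟨0, by simp [hT']⟩⟩
  unfold minHalfDistSq
  refine le_ciInf fun u => ?_
  rw [halfDistSq_mul_twist]
  have hu : |(s + (u : ℝ)) - s| ≤ T' := by
    rw [add_sub_cancel_left, abs_le]; exact ⟨u.2.1, u.2.2⟩
  obtain ⟨huT, hlow⟩ := hwin (s + u) hu
  have h := halfDistSq_ge_quarter_offDist_of_le_min hgb E huT hmin
  linarith

end Restricted

end Halasz

end Literature.NumberTheory.LFunctions

end
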